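import Literature.Computability.Complexity.Space
import Literature.Computability.Complexity.TM2Iterate
import Mathlib.Tactic.DeriveFintype
import HarnessLib

/-!
# Space-bounded iteration of a polynomial-time machine (the loop machine of `PSPACE` algorithms)

Trunk `CplxCore`, toolkit for `Space.lean` (the tree's space machines `SpaceMachine`, `DSPACE`,
`PSPACE`, after Arora–Barak 2009, Def. 4.1/4.5), companion of the TIME combinators
`TimeBoundsProofs.lean` (composition), `TM2Iterate.lean` (clocked iteration, whose machine design
and bookkeeping this file adapts) and `TM2Simulation.lean`. Main result:

* `SpaceLoop.mem_PSPACE`: let `F ∈ FP` and, for an input `x`, consider the **orbit**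
  `o₀ = F (0x)`, `o_{k+1} = F (1 o_k)` (`SpaceLoop.orbit`; the tag `0`/`1` tells the first round
  from the later ones). If every orbit word has length `≤ s(|x|)` for a polynomial `s`, and the
  orbit raises the FLAG (first symbol `1`) for the first time at a word `1 a w` whose second symbol
  is the ANSWER `a = [x ∈ L]`, then `L ∈ PSPACE`.

This is the generic shape of polynomial-SPACE algorithms that run for exponentially many rounds
while reusing the space of one polynomial-time round (Arora–Barak 2009, Thm. 4.2:
`DTIME(S) ⊆ SPACE(S)`, and §4.1: "space can be reused"): e.g. the enumeration of all coin strings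
in Gill's proof of `PP ⊆ PSPACE` (`MajorityEnumeration.lean`), of all certificates for
`NP ⊆ PSPACE`, or of all plays for `TQBF ∈ PSPACE`. Nothing of this is in Mathlib; in the tree it
is the first theorem putting a non-trivial class of languages inside `PSPACE`.

## The loop machine (`SpaceLoop.loopTM`, `SpaceLoop.spaceMachine`)

Given a bundled `M : Turing.FinTM2` computing `F` with identifications `eIn : M.Γ M.k₀ ≃ Bool`,
`eOut : M.Γ M.k₁ ≃ Bool`, the loop machine has stacks `M.K ⊕ Aux` with four Boolean auxiliary
stacks `IN` (the input stack of the space machine), `LEFT` (its left input stack: the two form the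
read-only input), `TMP` and `OUT` (its output stack), labels `M.Λ ⊕ Ctrl` with the control labels
`load, feed b, test, mv1, fin`, and states `M.σ × Option Bool × Option Bool` (two registers).
Control flow (`SpaceLoop.ctrlStmt`):

* `load`: pop `IN` symbol by symbol, pushing each symbol on `LEFT` (so `reverse LEFT ++ IN` is the
  input at all times) and on `TMP`; then `feed false`;
* `feed b`: pour `TMP` onto `k₀` (the second reversal restores the order), push the round tag `b`,
  and jump to `M.main`; the statements of `M` act on the first state component
  (`SpaceLoop.trStmt`), `halt` becoming `goto test`; `M` halts in `haltList` form (output on `k₁`,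
  its other stacks empty, state reset);
* `test`: pop the flag; on `1` pop the answer into the second register and go to `fin`; on `0`
  push it back, `mv1`: pour `k₁` onto `TMP`, and `feed true`;
* `fin`: push the answer on `OUT`, reset the state, `halt`.

## Proof architecture

1. `RunsVia f P a b` — a run from `a` to `b` ALL of whose configurations satisfy `P`
   (`trans`, `single`, `forall_reaches`: if the run ends in a halting configuration then every
   configuration reachable from `a` satisfies `P` — space bounds and the read-only-input
   condition concern every reachable configuration).
2. Stack bookkeeping `mkStk` and one-step lemmas for the control labels (`step_load_cons`, …),
   the exact simulation of `M` (`stepAux_trStmt`, `step_cfgM`, `runM`), phase lemmas through an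
   arbitrary predicate (`load_run`, `feed_run`, `mv1_run`), one round (`round_continue`,
   `round_halt`).
3. Accounting: `stkLen`, `ws` (work space: stacks of `M`, `TMP`, `OUT`), `inv` (read-only input),
   `Good`; the space of a run of `M` (`stkLen_le_of_iterate`, from `length_iterate_le` of
   `TimeBoundsProofs.lean`: `#stacks · machinePushBound` symbols per step); the full trajectory
   inside `Good (A + #stacks · D · T(A)) x` (`good_trajectory`), `A = |x| + s(|x|) + 2`.
4. `workSpace_eq_ws`, `decidesInSpace` (`DecidesInSpace` of `Space.lean`), and `mem_PSPACE`
   (the bound is a polynomial, dominated by `c n^k + c`, `exists_eval_le_mul_pow_add`).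

## References

* S. Arora, B. Barak, *Computational Complexity: A Modern Approach*, CUP 2009, Def. 4.1 (space
  machines with read-only input; only work tapes are charged), Def. 4.5 (`PSPACE`), Thm. 4.2 and
  its proof (`DTIME(S(n)) ⊆ SPACE(S(n))`: a machine touches at most one new cell per step), §4.1
  (reuse of space), §1.4.1 (simulation with counters). [AroraBarak2009]
* M. Sipser, *Introduction to the Theory of Computation*, 3rd ed., Thm. 8.5 ff. (`SAT ∈ PSPACE`
  by reusing space across the enumeration of assignments).
* Mathlib, `Mathlib/Computability/TuringMachine/Computable.lean` (`FinTM2`, `initList`,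
  `haltList`, `TM2OutputsInTime`).

## Design notes

* The round tag is pushed by the MACHINE (`feed b`), so that the iterated `F` can tell the raw
  input `0x` from a later state `1w` without any convention on inputs; the flag and the answer are
  the first two symbols of an output, tested by two `pop`s.
* Behaviour on outputs that are empty or never raise the flag is irrelevant: the hypotheses of
  `decidesInSpace`/`mem_PSPACE` exclude them, and `DecidesInSpace` only quantifies over
  configurations reachable from initial ones.
* All alphabets of the auxiliary stacks are `Bool`, so that the loop machine is literally a
  `SpaceMachine Bool Bool` with `Equiv.refl` identifications.
-/

namespace Literature.Computability.Complexity

namespace SpaceLoop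

open Turing StateTransition Function TM2Comp

/-! ### Runs all of whose configurations satisfy a predicate -/

section RunsVia

variable {C : Type}

/-- `RunsVia f P a b`: iterating the partial step function `f` from `a` reaches `b`, and every
configuration met on the way (both ends included) satisfies `P`. This is the bookkeeping device
for SPACE bounds (which concern every reachable configuration, not only the last one).
[folklore] -/
def RunsVia (f : C → Option C) (P : C → Prop) (a b : C) : Prop :=
  ∃ n, (flip bind f)^[n] (some a) = some b ∧
    ∀ i ≤ n, ∀ c, (flip bind f)^[i] (some a) = some c → P c

variable {f : C → Option C} {P Q : C → Prop} {a b c : C}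

/-- Zero steps. [folklore] -/
theorem RunsVia.refl (h : P a) : RunsVia f P a a :=
  ⟨0, rfl, fun i hi c hc => by
    obtain rfl := Nat.le_zero.1 hi
    simp only [iterate_zero, id_eq, Option.some.injEq] at hc
    exact hc ▸ h⟩

/-- The first configuration satisfies the predicate. [folklore] -/
theorem RunsVia.first (h : RunsVia f P a b) : P a := by
  obtain ⟨n, -, hP⟩ := h
  exact hP 0 (Nat.zero_le _) a rfl

/-- The last configuration satisfies the predicate. [folklore] -/
theorem RunsVia.last (h : RunsVia f P a b) : P b := by
  obtain ⟨n, e, hP⟩ := h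
  exact hP n le_rfl b e

/-- Concatenation. [folklore] -/
theorem RunsVia.trans (h₁ : RunsVia f P a b) (h₂ : RunsVia f P b c) : RunsVia f P a c := by
  obtain ⟨n₁, e₁, h₁⟩ := h₁
  obtain ⟨n₂, e₂, h₂⟩ := h₂
  refine ⟨n₂ + n₁, by rw [iterate_add_apply, e₁, e₂], fun i hi d hd => ?_⟩
  rcases le_or_gt i n₁ with h | h
  · exact h₁ i h d hd
  · obtain ⟨j, rfl⟩ := Nat.exists_eq_add_of_lt h
    have hd' : (flip bind f)^[j + 1] (some b) = some d := by
      rw [← e₁, ← iterate_add_apply, show j + 1 + n₁ = n₁ + j + 1 by omega]; exact hd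
    exact h₂ (j + 1) (by omega) d hd'

/-- One step. [folklore] -/
theorem RunsVia.single (e : f a = some b) (ha : P a) (hb : P b) : RunsVia f P a b := by
  refine ⟨1, by rw [iterate_bind_succ, e]; rfl, fun i hi d hd => ?_⟩
  rcases Nat.le_one_iff_eq_zero_or_eq_one.1 hi with rfl | rfl
  · simp only [iterate_zero, id_eq, Option.some.injEq] at hd; exact hd ▸ ha
  · rw [iterate_bind_succ, e] at hd
    simp only [iterate_zero, id_eq, Option.some.injEq] at hd; exact hd ▸ hb

/-- One step followed by a run. [folklore] -/
theorem RunsVia.step_trans (e : f a = some b) (ha : P a) (h₂ : RunsVia f P b c) : RunsVia f P a c :=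
  (RunsVia.single e ha h₂.first).trans h₂

/-- Weakening the predicate. [folklore] -/
theorem RunsVia.mono (hPQ : ∀ c, P c → Q c) (h : RunsVia f P a b) : RunsVia f Q a b := by
  obtain ⟨n, e, hP⟩ := h
  exact ⟨n, e, fun i hi d hd => hPQ d (hP i hi d hd)⟩

/-- A run from a list of single steps: if `g` enumerates configurations with `f (g i) = g (i+1)`
for `i < n` and all `g i`, `i ≤ n`, satisfy `P`, then `RunsVia f P (g 0) (g n)`. [folklore] -/
theorem RunsVia.of_chain (g : ℕ → C) (n : ℕ) (hstep : ∀ i < n, f (g i) = some (g (i + 1)))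
    (hP : ∀ i ≤ n, P (g i)) : RunsVia f P (g 0) (g n) := by
  induction n with
  | zero => exact RunsVia.refl (hP 0 le_rfl)
  | succ n ih =>
    have h1 : RunsVia f P (g 0) (g n) := ih (fun i hi => hstep i (by omega)) (fun i hi => hP i (by omega))
    exact h1.trans (RunsVia.single (hstep n (by omega)) (hP n (by omega)) (hP (n + 1) le_rfl))

/-- Reachability is witnessed by an iteration count. [folklore] -/
theorem exists_iterate_of_reaches (h : Reaches f a c) : ∃ n, (flip bind f)^[n] (some a) = some c := by
  induction h with
  | refl => exact ⟨0, rfl⟩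
  | tail _ hbc ih =>
    obtain ⟨n, hn⟩ := ih
    refine ⟨n + 1, ?_⟩
    rw [iterate_succ_apply', hn]
    exact hbc

/-- **Every configuration reachable from the start of a halting run satisfies the predicate.**
[folklore] -/
theorem RunsVia.forall_reaches (h : RunsVia f P a b) (hb : f b = none) (c : C) (hc : Reaches f a c) :
    P c := by
  obtain ⟨n, e, hP⟩ := h
  obtain ⟨i, hi⟩ := exists_iterate_of_reaches hc
  rcases le_or_gt i n with hle | hlt
  · exact hP i hle c hi
  · obtain ⟨j, rfl⟩ := Nat.exists_eq_add_of_lt hlt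
    rw [show n + j + 1 = (j + 1) + n by omega, iterate_add_apply, e, iterate_bind_succ, hb,
      iterate_bind_none] at hi
    cases hi

/-- The end of a halting run is the evaluation. [folklore] -/
theorem RunsVia.mem_eval (h : RunsVia f P a b) (hb : f b = none) : b ∈ eval f a := by
  obtain ⟨n, e, -⟩ := h
  exact StateTransition.mem_eval.2 ⟨reaches_of_iterate_flip_bind f n a b e, hb⟩

end RunsVia

/-! ### The loop machine: auxiliary stacks, control labels, alphabets -/

/-- The four auxiliary stacks of the loop machine: the input stack `IN` and the left input stack
`LEFT` (together the read-only input of the space machine), the transfer stack `TMP` and the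
output stack `OUT` (all over `Bool`). [folklore] -/
inductive Aux
  | IN
  | LEFT
  | TMP
  | OUT
  deriving DecidableEq, Fintype

/-- The control labels of the loop machine (besides the labels of the iterated machine):
`load` (read the input once, keeping it on `LEFT` and a copy on `TMP`), `feed b` (pour `TMP` onto
the input stack of the iterated machine and push the round tag `b`), `test` (inspect the flag of
the output), `mv1` (pour the output onto `TMP`), `fin` (emit the answer and halt). [folklore] -/
inductive Ctrl
  | load
  | feed (b : Bool)
  | test
  | mv1
  | fin
  deriving DecidableEq, Fintype

section Machine

variable {K : Type} {G : K → Type} {Λ σ : Type}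

/-- Stack alphabets of the loop machine: those of the iterated machine on `inl`, `Bool` on the
auxiliary stacks. Written with `casesOn` so that it unfolds by `rfl` on constructors. [folklore] -/
abbrev LoopΓ (G : K → Type) : K ⊕ Aux → Type := fun j =>
  Sum.casesOn (motive := fun _ => Type) j G (fun _ => Bool)

/-- Internal states of the loop machine: a state of the iterated machine and two registers for
popped symbols (`none` between control steps). [folklore] -/
abbrev St (σ : Type) : Type := σ × Option Bool × Option Bool

/-- Reset both registers. [folklore] -/
def rst : St σ → St σ := fun v => (v.1, none, none)

/-- Stack contents of the loop machine from the stacks `S` of the iterated machine and the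
contents `i`, `lf`, `t`, `o` of `IN`, `LEFT`, `TMP`, `OUT`. [folklore] -/
def mkStk (S : ∀ k, List (G k)) (i lf t o : List Bool) : ∀ j : K ⊕ Aux, List (LoopΓ G j)
  | Sum.inl k => S k
  | Sum.inr Aux.IN => i
  | Sum.inr Aux.LEFT => lf
  | Sum.inr Aux.TMP => t
  | Sum.inr Aux.OUT => o

section StkLemmas

variable (S : ∀ k, List (G k)) (i lf t o : List Bool)

/-- Reading a stack of the iterated machine. [folklore] -/
@[simp] theorem mkStk_inl (k : K) : mkStk S i lf t o (Sum.inl k) = S k := rfl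
/-- Reading `IN`. [folklore] -/
@[simp] theorem mkStk_IN : mkStk S i lf t o (Sum.inr Aux.IN) = i := rfl
/-- Reading `LEFT`. [folklore] -/
@[simp] theorem mkStk_LEFT : mkStk S i lf t o (Sum.inr Aux.LEFT) = lf := rfl
/-- Reading `TMP`. [folklore] -/
@[simp] theorem mkStk_TMP : mkStk S i lf t o (Sum.inr Aux.TMP) = t := rfl
/-- Reading `OUT`. [folklore] -/
@[simp] theorem mkStk_OUT : mkStk S i lf t o (Sum.inr Aux.OUT) = o := rfl

variable {dKA : DecidableEq (K ⊕ Aux)}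

/-- Writing a stack of the iterated machine (any decidability instance on `K ⊕ Aux`, so that the
lemma also fires on the instance bundled in a `FinTM2`). [folklore] -/
@[simp] theorem mkStk_update_inl [DecidableEq K] (k : K) (L : List (G k)) :
    @update _ _ dKA (mkStk S i lf t o) (Sum.inl k) L = mkStk (update S k L) i lf t o := by
  funext j
  rcases j with k' | a
  · rcases eq_or_ne k' k with rfl | h
    · simp
    · rw [update_of_ne (by simpa using h)]; simp [update_of_ne h]
  · rw [update_of_ne (by simp)]; cases a <;> rfl

/-- Writing `IN`. [folklore] -/
@[simp] theorem mkStk_update_IN (i' : List Bool) :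
    @update _ _ dKA (mkStk S i lf t o) (Sum.inr Aux.IN) i' = mkStk S i' lf t o := by
  funext j
  rcases j with k' | a
  · rw [update_of_ne (by simp)]; rfl
  · cases a
    · simp
    all_goals rw [update_of_ne (by simp)]; rfl

/-- Writing `LEFT`. [folklore] -/
@[simp] theorem mkStk_update_LEFT (lf' : List Bool) :
    @update _ _ dKA (mkStk S i lf t o) (Sum.inr Aux.LEFT) lf' = mkStk S i lf' t o := by
  funext j
  rcases j with k' | a
  · rw [update_of_ne (by simp)]; rfl
  · cases a
    case LEFT => simp
    all_goals rw [update_of_ne (by simp)]; rfl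

/-- Writing `TMP`. [folklore] -/
@[simp] theorem mkStk_update_TMP (t' : List Bool) :
    @update _ _ dKA (mkStk S i lf t o) (Sum.inr Aux.TMP) t' = mkStk S i lf t' o := by
  funext j
  rcases j with k' | a
  · rw [update_of_ne (by simp)]; rfl
  · cases a
    case TMP => simp
    all_goals rw [update_of_ne (by simp)]; rfl

/-- Writing `OUT`. [folklore] -/
@[simp] theorem mkStk_update_OUT (o' : List Bool) :
    @update _ _ dKA (mkStk S i lf t o) (Sum.inr Aux.OUT) o' = mkStk S i lf t o' := by
  funext j
  rcases j with k' | a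
  · rw [update_of_ne (by simp)]; rfl
  · cases a
    case OUT => simp
    all_goals rw [update_of_ne (by simp)]; rfl

/-- The empty stack assignment. [folklore] -/
theorem mkStk_bot :
    mkStk (fun k => ([] : List (G k))) [] [] [] [] = fun j => ([] : List (LoopΓ G j)) := by
  funext j
  rcases j with k | a
  · rfl
  · cases a <;> rfl

/-- The initial stack assignment of the loop machine (input word on `IN`). [folklore] -/
theorem mkStk_bot_IN [DecidableEq K] (l : List Bool) :
    mkStk (fun k => ([] : List (G k))) l [] [] [] =
      update (fun j => ([] : List (LoopΓ G j))) (Sum.inr Aux.IN) l := by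
  rw [← mkStk_bot, mkStk_update_IN]

end StkLemmas

/-- Translation of the statements of the iterated machine: act on the `inl` stacks and the first
state component; `halt` becomes a jump to the control label `test`. [folklore] -/
def trStmt : TM2.Stmt G Λ σ → TM2.Stmt (LoopΓ G) (Λ ⊕ Ctrl) (St σ)
  | TM2.Stmt.push k f q => TM2.Stmt.push (Sum.inl k) (fun s => f s.1) (trStmt q)
  | TM2.Stmt.peek k f q => TM2.Stmt.peek (Sum.inl k) (fun s x => (f s.1 x, s.2)) (trStmt q)
  | TM2.Stmt.pop k f q => TM2.Stmt.pop (Sum.inl k) (fun s x => (f s.1 x, s.2)) (trStmt q)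
  | TM2.Stmt.load f q => TM2.Stmt.load (fun s => (f s.1, s.2)) (trStmt q)
  | TM2.Stmt.branch p q₁ q₂ => TM2.Stmt.branch (fun s => p s.1) (trStmt q₁) (trStmt q₂)
  | TM2.Stmt.goto l => TM2.Stmt.goto fun s => Sum.inl (l s.1)
  | TM2.Stmt.halt => TM2.Stmt.goto fun _ => Sum.inr Ctrl.test

/-- Configuration of the loop machine while the iterated machine runs: its auxiliary stacks are
empty except `LEFT` (holding the input, reversed); the halting label is sent to `test`. [folklore] -/
def cfgM (c : TM2.Cfg G Λ σ) (lf : List Bool) : TM2.Cfg (LoopΓ G) (Λ ⊕ Ctrl) (St σ) :=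
  ⟨some (c.l.elim (Sum.inr Ctrl.test) Sum.inl), (c.var, none, none), mkStk c.stk [] lf [] []⟩

/-- One statement of the iterated machine is simulated exactly by its translation. [folklore] -/
theorem stepAux_trStmt [DecidableEq K] (q : TM2.Stmt G Λ σ) (v : σ) (S : ∀ k, List (G k))
    (lf : List Bool) :
    TM2.stepAux (trStmt q) ((v, none, none) : St σ) (mkStk S [] lf [] []) =
      cfgM (TM2.stepAux q v S) lf := by
  induction q generalizing v S with
  | push k f q ih =>
    simp only [trStmt, TM2.stepAux]
    rw [← ih, mkStk_inl, mkStk_update_inl]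
  | peek k f q ih => simp only [trStmt, TM2.stepAux]; exact ih _ _
  | pop k f q ih =>
    simp only [trStmt, TM2.stepAux]
    rw [← ih, mkStk_inl, mkStk_update_inl]
  | load f q ih => simp only [trStmt, TM2.stepAux]; exact ih _ _
  | branch p q₁ q₂ ih₁ ih₂ =>
    simp only [trStmt, TM2.stepAux]
    cases p v
    · exact ih₂ _ _
    · exact ih₁ _ _
  | goto l => rfl
  | halt => rfl

variable (k₀ k₁ : K) (eIn : G k₀ ≃ Bool) (eOut : G k₁ ≃ Bool) (main : Λ) (init : σ)

/-- The control statements of the loop machine.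
* `load`: pop the input stack `IN` symbol by symbol, pushing each symbol both on `LEFT` (so that
  `reverse LEFT ++ IN` is always the input: the read-only input convention of space machines) and
  on `TMP` (a work copy); when `IN` is exhausted, continue with `feed false`;
* `feed b`: pour `TMP` onto the input stack `k₀` of the iterated machine (this second reversal
  restores the order), then push the round tag `b` on top and start the iterated machine;
* `test` (reached when the iterated machine halts, output on `k₁`): pop the first output symbol,
  the FLAG; if it is `1`, pop the second symbol, the ANSWER, into the second register and go to
  `fin`; if it is `0`, push it back and go to `mv1` (empty output: go to `fin`);
* `mv1`: pour `k₁` onto `TMP`, then `feed true`;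
* `fin`: push the answer (second register, default `0`) on `OUT`, reset the state and halt.
[cite: AroraBarak2009, Thm. 4.2 and §4.1 (space-bounded computation reuses space across the iterations)] -/
def ctrlStmt : Ctrl → TM2.Stmt (LoopΓ G) (Λ ⊕ Ctrl) (St σ)
  | Ctrl.load =>
      TM2.Stmt.pop (Sum.inr Aux.IN) (fun v a => (v.1, a, none)) <|
        TM2.Stmt.branch (fun v => v.2.1.isNone)
          (TM2.Stmt.load rst <| TM2.Stmt.goto fun _ => Sum.inr (Ctrl.feed false))
          (TM2.Stmt.push (Sum.inr Aux.LEFT) (fun v => v.2.1.getD false) <|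
            TM2.Stmt.push (Sum.inr Aux.TMP) (fun v => v.2.1.getD false) <|
              TM2.Stmt.load rst <| TM2.Stmt.goto fun _ => Sum.inr Ctrl.load)
  | Ctrl.feed b =>
      TM2.Stmt.pop (Sum.inr Aux.TMP) (fun v a => (v.1, a, none)) <|
        TM2.Stmt.branch (fun v => v.2.1.isNone)
          (TM2.Stmt.push (Sum.inl k₀) (fun _ => eIn.symm b) <| TM2.Stmt.load rst <|
            TM2.Stmt.goto fun _ => Sum.inl main)
          (TM2.Stmt.push (Sum.inl k₀) (fun v => eIn.symm (v.2.1.getD false)) <| TM2.Stmt.load rst <|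
            TM2.Stmt.goto fun _ => Sum.inr (Ctrl.feed b))
  | Ctrl.test =>
      TM2.Stmt.pop (Sum.inl k₁) (fun v a => (v.1, a.map eOut, none)) <|
        TM2.Stmt.branch (fun v => v.2.1.isNone)
          (TM2.Stmt.load rst <| TM2.Stmt.goto fun _ => Sum.inr Ctrl.fin)
          (TM2.Stmt.branch (fun v => v.2.1.getD false)
            (TM2.Stmt.pop (Sum.inl k₁) (fun v a => (v.1, v.2.1, a.map eOut)) <|
              TM2.Stmt.goto fun _ => Sum.inr Ctrl.fin)
            (TM2.Stmt.push (Sum.inl k₁) (fun _ => eOut.symm false) <| TM2.Stmt.load rst <|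
              TM2.Stmt.goto fun _ => Sum.inr Ctrl.mv1))
  | Ctrl.mv1 =>
      TM2.Stmt.pop (Sum.inl k₁) (fun v a => (v.1, a.map eOut, none)) <|
        TM2.Stmt.branch (fun v => v.2.1.isNone)
          (TM2.Stmt.load rst <| TM2.Stmt.goto fun _ => Sum.inr (Ctrl.feed true))
          (TM2.Stmt.push (Sum.inr Aux.TMP) (fun v => v.2.1.getD false) <| TM2.Stmt.load rst <|
            TM2.Stmt.goto fun _ => Sum.inr Ctrl.mv1)
  | Ctrl.fin =>
      TM2.Stmt.push (Sum.inr Aux.OUT) (fun v => v.2.2.getD false) <|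
        TM2.Stmt.load (fun _ => (init, none, none)) TM2.Stmt.halt

end Machine

/-! ### Bundling: the loop machine as a `FinTM2` and as a space machine -/

section Bundled

variable (M : FinTM2)

/-- Configurations of the loop machine with reset registers, from the label, the `M`-state, the
stacks of `M` and the four auxiliary stacks. [folklore] -/
def cfg (l : Option (M.Λ ⊕ Ctrl)) (v : M.σ) (S : ∀ k, List (M.Γ k)) (i lf t o : List Bool) :
    TM2.Cfg (LoopΓ M.Γ) (M.Λ ⊕ Ctrl) (St M.σ) :=
  ⟨l, (v, none, none), mkStk S i lf t o⟩

/-- The (unbundled) type of configurations of the loop machine. [folklore] -/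
abbrev LCfg : Type := TM2.Cfg (LoopΓ M.Γ) (M.Λ ⊕ Ctrl) (St M.σ)

variable (eIn : M.Γ M.k₀ ≃ Bool) (eOut : M.Γ M.k₁ ≃ Bool)

/-- **The loop machine** of a bundled TM2 machine `M` with Boolean input and output alphabets:
stacks `M.K ⊕ Aux` (input stack `IN`, output stack `OUT`), labels `M.Λ ⊕ Ctrl` (main label
`load`), states `M.σ × Option Bool × Option Bool`. On input `x` it runs `M` on `0x`, then
repeatedly on `1w` for the previous output `w`, until an output starts with the flag `1`; the
symbol after the flag is the answer. [cite: AroraBarak2009, Thm. 4.2 and §4.1] -/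
noncomputable def loopTM : FinTM2 :=
  letI := M.kFin; letI := M.ΛFin; letI := M.σFin
  { K := M.K ⊕ Aux
    k₀ := Sum.inr Aux.IN
    k₁ := Sum.inr Aux.OUT
    Γ := LoopΓ M.Γ
    Λ := M.Λ ⊕ Ctrl
    main := Sum.inr Ctrl.load
    σ := St M.σ
    initialState := (M.initialState, none, none)
    Γk₀Fin := (inferInstance : Fintype Bool)
    m := fun l => match l with
      | Sum.inl l => trStmt (M.m l)
      | Sum.inr c => ctrlStmt M.k₀ M.k₁ eIn eOut M.main M.initialState c }

/-- **The loop machine as a space machine**: read-only input on `LEFT`/`IN`, output on `OUT`.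
[cite: AroraBarak2009, Def. 4.1] -/
noncomputable def spaceMachine : SpaceMachine Bool Bool where
  tm := loopTM M eIn eOut
  inputAlphabet := Equiv.refl Bool
  outputAlphabet := Equiv.refl Bool
  kL := Sum.inr Aux.LEFT
  kL_ne_k₀ := by simp [loopTM]
  kL_ne_k₁ := by simp [loopTM]
  leftAlphabet := Equiv.refl Bool

/-- A step of the loop machine at a control label, unbundled. [folklore] -/
theorem step_inr (c : Ctrl) (var : St M.σ) (stk : ∀ j, List (LoopΓ M.Γ j)) :
    (loopTM M eIn eOut).step (⟨some (Sum.inr c), var, stk⟩ : LCfg M) =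
      some (TM2.stepAux (ctrlStmt M.k₀ M.k₁ eIn eOut M.main M.initialState c) var stk) :=
  rfl

/-- A step of the loop machine at a label of the iterated machine, unbundled. [folklore] -/
theorem step_inl (l : M.Λ) (var : St M.σ) (stk : ∀ j, List (LoopΓ M.Γ j)) :
    (loopTM M eIn eOut).step (⟨some (Sum.inl l), var, stk⟩ : LCfg M) =
      some (TM2.stepAux (trStmt (M.m l)) var stk) :=
  rfl

/-- The halted loop machine does not move. [folklore] -/
theorem step_none (var : St M.σ) (stk : ∀ j, List (LoopΓ M.Γ j)) :
    (loopTM M eIn eOut).step (⟨none, var, stk⟩ : LCfg M) = none :=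
  rfl

/-! ### Single steps of the control labels -/

section Steps

variable (v : M.σ) (S : ∀ k, List (M.Γ k)) (i lf t o : List Bool)

/-- `load` on a nonempty input stack: the symbol goes to `LEFT` and to `TMP`. [folklore] -/
theorem step_load_cons (s : Bool) :
    (loopTM M eIn eOut).step (cfg M (some (Sum.inr Ctrl.load)) v S (s :: i) lf t o) =
      some (cfg M (some (Sum.inr Ctrl.load)) v S i (s :: lf) (s :: t) o) := by
  rw [cfg, step_inr]; simp [ctrlStmt, rst, cfg]

/-- `load` on an empty input stack: proceed to `feed false`. [folklore] -/
theorem step_load_nil :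
    (loopTM M eIn eOut).step (cfg M (some (Sum.inr Ctrl.load)) v S [] lf t o) =
      some (cfg M (some (Sum.inr (Ctrl.feed false))) v S [] lf t o) := by
  rw [cfg, step_inr]; simp [ctrlStmt, rst, cfg]

/-- `feed b` on nonempty `TMP`: move one symbol to `k₀` (through `eIn.symm`). [folklore] -/
theorem step_feed_cons (b s : Bool) :
    (loopTM M eIn eOut).step (cfg M (some (Sum.inr (Ctrl.feed b))) v S i lf (s :: t) o) =
      some (cfg M (some (Sum.inr (Ctrl.feed b))) v (update S M.k₀ (eIn.symm s :: S M.k₀)) i lf t o) := by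
  rw [cfg, step_inr]; simp [ctrlStmt, rst, cfg]

/-- `feed b` on empty `TMP`: push the tag `b` on `k₀` and start the iterated machine. [folklore] -/
theorem step_feed_nil (b : Bool) :
    (loopTM M eIn eOut).step (cfg M (some (Sum.inr (Ctrl.feed b))) v S i lf [] o) =
      some (cfg M (some (Sum.inl M.main)) v (update S M.k₀ (eIn.symm b :: S M.k₀)) i lf [] o) := by
  rw [cfg, step_inr]; simp [ctrlStmt, rst, cfg]

/-- `test` on an output flagged `1`: pop flag and answer, go to `fin` with the answer in the
second register. [folklore] -/
theorem step_test_true (a : Bool) (L : List (M.Γ M.k₁)) :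
    (loopTM M eIn eOut).step
        (cfg M (some (Sum.inr Ctrl.test)) v (update S M.k₁ (eOut.symm true :: eOut.symm a :: L)) i lf t o) =
      some ⟨some (Sum.inr Ctrl.fin), (v, some true, some a), mkStk (update S M.k₁ L) i lf t o⟩ := by
  rw [cfg, step_inr]; simp [ctrlStmt]; rfl

/-- `test` on an output flagged `0`: push the flag back and go to `mv1`. [folklore] -/
theorem step_test_false (L : List (M.Γ M.k₁)) :
    (loopTM M eIn eOut).step
        (cfg M (some (Sum.inr Ctrl.test)) v (update S M.k₁ (eOut.symm false :: L)) i lf t o) =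
      some (cfg M (some (Sum.inr Ctrl.mv1)) v (update S M.k₁ (eOut.symm false :: L)) i lf t o) := by
  rw [cfg, step_inr]; simp [ctrlStmt, rst, cfg]

/-- `mv1` on nonempty `k₁`: move one symbol to `TMP` (through `eOut`). [folklore] -/
theorem step_mv1_cons (g : M.Γ M.k₁) (L : List (M.Γ M.k₁)) :
    (loopTM M eIn eOut).step (cfg M (some (Sum.inr Ctrl.mv1)) v (update S M.k₁ (g :: L)) i lf t o) =
      some (cfg M (some (Sum.inr Ctrl.mv1)) v (update S M.k₁ L) i lf (eOut g :: t) o) := by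
  rw [cfg, step_inr]; simp [ctrlStmt, rst, cfg]

/-- `mv1` on empty `k₁`: proceed to `feed true`. [folklore] -/
theorem step_mv1_nil :
    (loopTM M eIn eOut).step (cfg M (some (Sum.inr Ctrl.mv1)) v (update S M.k₁ []) i lf t o) =
      some (cfg M (some (Sum.inr (Ctrl.feed true))) v (update S M.k₁ []) i lf t o) := by
  rw [cfg, step_inr]; simp [ctrlStmt, rst, cfg]

/-- `fin`: emit the answer held in the second register, reset the state and halt. [folklore] -/
theorem step_fin (r : Option Bool) (a : Bool) :
    (loopTM M eIn eOut).step (⟨some (Sum.inr Ctrl.fin), (v, r, some a), mkStk S i lf t o⟩ : LCfg M) =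
      some (cfg M none M.initialState S i lf t (a :: o)) := by
  rw [step_inr]; simp [ctrlStmt, cfg]

/-- A step of the iterated machine `M` is a step of the loop machine on the embedded
configuration. [folklore] -/
theorem step_cfgM (a b : M.Cfg) (h : M.step a = some b) (lf : List Bool) :
    (loopTM M eIn eOut).step (cfgM a lf) = some (cfgM b lf) := by
  obtain ⟨_ | l, w, S'⟩ := a
  · simp [FinTM2.step, TM2.step] at h
  · simp only [FinTM2.step, TM2.step] at h
    obtain rfl := Option.some.inj h
    simp only [cfgM, Option.elim]
    rw [step_inl, stepAux_trStmt]
    rfl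

end Steps

/-! ### Phases of the loop machine (runs through a predicate) -/

section Phases

variable (P : LCfg M → Prop) (v : M.σ) (S : ∀ k, List (M.Γ k))

/-- `load`: the input `i` is moved onto `LEFT` and copied onto `TMP` (both reversed), then the
machine proceeds to `feed false`; the run stays inside `P` if all the displayed configurations
satisfy `P`. [folklore] -/
theorem load_run (lf t o : List Bool) : ∀ i : List Bool,
    (∀ i₁ i₂, i₁ ++ i₂ = i →
      P (cfg M (some (Sum.inr Ctrl.load)) v S i₂ (i₁.reverse ++ lf) (i₁.reverse ++ t) o)) →
    P (cfg M (some (Sum.inr (Ctrl.feed false))) v S [] (i.reverse ++ lf) (i.reverse ++ t) o) →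
    RunsVia (C := LCfg M) (loopTM M eIn eOut).step P (cfg M (some (Sum.inr Ctrl.load)) v S i lf t o)
      (cfg M (some (Sum.inr (Ctrl.feed false))) v S [] (i.reverse ++ lf) (i.reverse ++ t) o) := by
  intro i
  induction i generalizing lf t with
  | nil =>
    intro hP hend
    simpa using RunsVia.single (step_load_nil M eIn eOut v S lf t o) (by simpa using hP [] [] rfl)
      (by simpa using hend)
  | cons s i ih =>
    intro hP hend
    have h0 : P (cfg M (some (Sum.inr Ctrl.load)) v S (s :: i) lf t o) := by
      simpa using hP [] (s :: i) rfl
    have h1 := ih (s :: lf) (s :: t)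
      (fun i₁ i₂ h => by simpa [List.append_assoc] using hP (s :: i₁) i₂ (by simp [h]))
      (by simpa [List.append_assoc] using hend)
    simpa [List.append_assoc] using RunsVia.step_trans (step_load_cons M eIn eOut v S i lf t o s) h0 h1

/-- `feed b`: `TMP` is moved (reversed, written through `eIn.symm`) on top of the input stack `k₀`
of `M`, then the tag `b` is pushed and the machine jumps to the main label of `M`. [folklore] -/
theorem feed_run (b : Bool) (i lf o : List Bool) : ∀ (t : List Bool) (S : ∀ k, List (M.Γ k)),
    (∀ t₁ t₂, t₁ ++ t₂ = t →
      P (cfg M (some (Sum.inr (Ctrl.feed b))) v (update S M.k₀ (t₁.reverse.map eIn.symm ++ S M.k₀)) i lf t₂ o)) →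
    P (cfg M (some (Sum.inl M.main)) v
      (update S M.k₀ (eIn.symm b :: (t.reverse.map eIn.symm ++ S M.k₀))) i lf [] o) →
    RunsVia (C := LCfg M) (loopTM M eIn eOut).step P (cfg M (some (Sum.inr (Ctrl.feed b))) v S i lf t o)
      (cfg M (some (Sum.inl M.main)) v
        (update S M.k₀ (eIn.symm b :: (t.reverse.map eIn.symm ++ S M.k₀))) i lf [] o) := by
  intro t
  induction t with
  | nil =>
    intro S hP hend
    have h0 := hP [] [] rfl
    simp only [List.reverse_nil, List.map_nil, List.nil_append, update_eq_self] at h0 hend ⊢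
    exact RunsVia.single (step_feed_nil M eIn eOut v S i lf o b) h0 hend
  | cons s t ih =>
    intro S hP hend
    have h0 : P (cfg M (some (Sum.inr (Ctrl.feed b))) v S i lf (s :: t) o) := by
      simpa using hP [] (s :: t) rfl
    have h1 := ih (update S M.k₀ (eIn.symm s :: S M.k₀))
      (fun t₁ t₂ h => by
        have := hP (s :: t₁) t₂ (by simp [h])
        simp only [update_idem, update_self]
        simpa [List.append_assoc] using this)
      (by
        simp only [update_idem, update_self]
        simpa [List.append_assoc] using hend)
    simp only [update_idem, update_self] at h1
    simpa [List.append_assoc] using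
      RunsVia.step_trans (step_feed_cons M eIn eOut v S i lf t o b s) h0 h1

/-- `mv1`: the output stack `k₁` of `M` is moved (reversed, read through `eOut`) onto `TMP`, then
the machine proceeds to `feed true`. [folklore] -/
theorem mv1_run (i lf o : List Bool) : ∀ (L : List (M.Γ M.k₁)) (t : List Bool),
    (∀ L₁ L₂, L₁ ++ L₂ = L →
      P (cfg M (some (Sum.inr Ctrl.mv1)) v (update S M.k₁ L₂) i lf (L₁.reverse.map eOut ++ t) o)) →
    P (cfg M (some (Sum.inr (Ctrl.feed true))) v (update S M.k₁ []) i lf (L.reverse.map eOut ++ t) o) →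
    RunsVia (C := LCfg M) (loopTM M eIn eOut).step P (cfg M (some (Sum.inr Ctrl.mv1)) v (update S M.k₁ L) i lf t o)
      (cfg M (some (Sum.inr (Ctrl.feed true))) v (update S M.k₁ []) i lf (L.reverse.map eOut ++ t) o) := by
  intro L
  induction L with
  | nil =>
    intro t hP hend
    simpa using RunsVia.single (step_mv1_nil M eIn eOut v S i lf t o) (by simpa using hP [] [] rfl)
      (by simpa using hend)
  | cons g L ih =>
    intro t hP hend
    have h0 : P (cfg M (some (Sum.inr Ctrl.mv1)) v (update S M.k₁ (g :: L)) i lf t o) := by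
      simpa using hP [] (g :: L) rfl
    have h1 := ih (eOut g :: t)
      (fun L₁ L₂ h => by simpa [List.append_assoc] using hP (g :: L₁) L₂ (by simp [h]))
      (by simpa [List.append_assoc] using hend)
    simpa [List.append_assoc] using
      RunsVia.step_trans (step_mv1_cons M eIn eOut v S i lf t o g L) h0 h1

/-- A prefix of a defined run is defined. [folklore] -/
theorem exists_iterate_of_le {C : Type} {f : C → Option C} {a b : C} {n i : ℕ}
    (h : (flip bind f)^[n] (some a) = some b) (hi : i ≤ n) :
    ∃ d, (flip bind f)^[i] (some a) = some d := by
  obtain ⟨j, rfl⟩ := Nat.exists_eq_add_of_le hi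
  cases hd : (flip bind f)^[i] (some a) with
  | none => rw [Nat.add_comm, iterate_add_apply, hd, iterate_bind_none] at h; cases h
  | some d => exact ⟨d, rfl⟩

/-- **A run of the iterated machine** `M` is a run of the loop machine on embedded configurations,
inside `P` if all embedded intermediate configurations are. [folklore] -/
theorem runM {n : ℕ} {a b : M.Cfg} (h : (flip bind M.step)^[n] (some a) = some b) (lf : List Bool)
    (hP : ∀ j ≤ n, ∀ d, (flip bind M.step)^[j] (some a) = some d → P (cfgM d lf)) :
    RunsVia (C := LCfg M) (loopTM M eIn eOut).step P (cfgM a lf) (cfgM b lf) := by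
  refine ⟨n, iterate_bind_map M.step (loopTM M eIn eOut).step (fun c => cfgM c lf)
    (fun c d hcd => step_cfgM M eIn eOut c d hcd lf) n a b h, fun i hi c hc => ?_⟩
  obtain ⟨d, hd⟩ := exists_iterate_of_le h hi
  have := iterate_bind_map M.step (loopTM M eIn eOut).step (fun c => cfgM c lf)
    (fun c d hcd => step_cfgM M eIn eOut c d hcd lf) i a d hd
  have e : some (cfgM d lf) = some c := this.symm.trans hc
  obtain rfl := Option.some.inj e
  exact hP i hi d hd

/-- The empty stack assignment of `M`. [folklore] -/
abbrev botStk : ∀ k, List (M.Γ k) := fun _ => []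

/-- Emptying an empty stack. [folklore] -/
theorem update_botStk_nil (k : M.K) : update (botStk M) k [] = botStk M := by
  funext j; by_cases h : j = k
  · subst h; simp
  · simp [update_of_ne h]

/-- The initial configuration of the loop machine. [folklore] -/
theorem initList_loopTM (l : List Bool) :
    initList (loopTM M eIn eOut) l =
      cfg M (some (Sum.inr Ctrl.load)) M.initialState (botStk M) l [] [] [] := by
  rw [initList_eq]
  change (⟨some (Sum.inr Ctrl.load), (M.initialState, none, none),
      update (fun j => ([] : List (LoopΓ M.Γ j))) (Sum.inr Aux.IN) l⟩ : LCfg M) = _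
  rw [← mkStk_bot_IN]
  rfl

/-- The embedded initial configuration of `M` on input `l`. [folklore] -/
theorem cfgM_initList (l : List (M.Γ M.k₀)) (lf : List Bool) :
    cfgM (initList M l) lf =
      cfg M (some (Sum.inl M.main)) M.initialState (update (botStk M) M.k₀ l) [] lf [] [] := by
  rw [initList_eq]; rfl

/-- The embedded halting configuration of `M` with output `L`: the loop machine is at `test`.
[folklore] -/
theorem cfgM_haltList (L : List (M.Γ M.k₁)) (lf : List Bool) :
    cfgM (haltList M L) lf =
      cfg M (some (Sum.inr Ctrl.test)) M.initialState (update (botStk M) M.k₁ L) [] lf [] [] := by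
  rw [haltList_eq]; rfl

/-- Reading back a word written through `eOut.symm`. [folklore] -/
theorem map_reverse_map_symm (w : List Bool) :
    ((w.map eOut.symm).reverse).map eOut = w.reverse := by
  simp [List.map_reverse]

/-- **One round, continuing.** If `M` maps the word `u` to an output `0w` (flag down), then from the
embedded start of `M` on `u` the loop machine reaches the embedded start of `M` on `1 0 w`, inside
`P` if the displayed intermediate configurations are. [folklore] -/
theorem round_continue (lf u w : List Bool) {n : ℕ}
    (hrun : (flip bind M.step)^[n] (some (initList M (u.map eIn.symm))) =
      some (haltList M ((false :: w).map eOut.symm)))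
    (hP_M : ∀ j ≤ n, ∀ d, (flip bind M.step)^[j] (some (initList M (u.map eIn.symm))) = some d →
      P (cfgM d lf))
    (hP_mv1 : ∀ L₁ L₂, L₁ ++ L₂ = (false :: w).map eOut.symm →
      P (cfg M (some (Sum.inr Ctrl.mv1)) M.initialState (update (botStk M) M.k₁ L₂) [] lf
        (L₁.reverse.map eOut) []))
    (hP_feed : ∀ t₁ t₂, t₁ ++ t₂ = (false :: w).reverse →
      P (cfg M (some (Sum.inr (Ctrl.feed true))) M.initialState
        (update (botStk M) M.k₀ (t₁.reverse.map eIn.symm)) [] lf t₂ []))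
    (hP_end : P (cfgM (initList M ((true :: false :: w).map eIn.symm)) lf)) :
    RunsVia (C := LCfg M) (loopTM M eIn eOut).step P (cfgM (initList M (u.map eIn.symm)) lf)
      (cfgM (initList M ((true :: false :: w).map eIn.symm)) lf) := by
  -- the run of `M`, ending at `test` with the output `0 w` on `k₁`
  have h1 := runM M eIn eOut P hrun lf hP_M
  rw [cfgM_haltList] at h1
  -- `test`: flag down, push it back and go to `mv1`
  have e2 : (loopTM M eIn eOut).step (cfg M (some (Sum.inr Ctrl.test)) M.initialState
      (update (botStk M) M.k₁ ((false :: w).map eOut.symm)) [] lf [] []) =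
      some (cfg M (some (Sum.inr Ctrl.mv1)) M.initialState
        (update (botStk M) M.k₁ ((false :: w).map eOut.symm)) [] lf [] []) :=
    step_test_false M eIn eOut M.initialState (botStk M) [] lf [] [] (w.map eOut.symm)
  -- the shape of the end configuration
  have hend_eq : cfgM (initList M ((true :: false :: w).map eIn.symm)) lf =
      cfg M (some (Sum.inl M.main)) M.initialState
        (update (update (botStk M) M.k₁ []) M.k₀ (eIn.symm true ::
          (((((false :: w).map eOut.symm).reverse.map eOut ++ []).reverse.map eIn.symm) ++
            update (botStk M) M.k₁ [] M.k₀))) [] lf [] [] := by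
    rw [cfgM_initList, update_botStk_nil]
    simp [List.map_reverse]
  -- `mv1`
  have h3 := mv1_run M eIn eOut P M.initialState (botStk M) [] lf [] ((false :: w).map eOut.symm) []
    (fun L₁ L₂ h => by simpa using hP_mv1 L₁ L₂ h)
    (by simpa [update_botStk_nil, List.map_reverse] using hP_feed [] (false :: w).reverse (by simp))
  -- `feed true`
  have h4 := feed_run M eIn eOut P M.initialState true [] lf []
    (((false :: w).map eOut.symm).reverse.map eOut ++ []) (update (botStk M) M.k₁ [])
    (fun t₁ t₂ h => by
      have h' : t₁ ++ t₂ = (false :: w).reverse := by simpa [List.map_reverse] using h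
      simpa [update_botStk_nil] using hP_feed t₁ t₂ h')
    (by rw [← hend_eq]; exact hP_end)
  rw [hend_eq]
  exact h1.trans (RunsVia.step_trans e2 h1.last (h3.trans h4))

/-- **One round, halting.** If `M` maps the word `u` to an output `1 a w` (flag up, answer `a`),
then from the embedded start of `M` on `u` the loop machine halts with `a` on `OUT`, inside `P` if
the displayed intermediate configurations are. [folklore] -/
theorem round_halt (lf u w : List Bool) (a : Bool) {n : ℕ}
    (hrun : (flip bind M.step)^[n] (some (initList M (u.map eIn.symm))) =
      some (haltList M ((true :: a :: w).map eOut.symm)))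
    (hP_M : ∀ j ≤ n, ∀ d, (flip bind M.step)^[j] (some (initList M (u.map eIn.symm))) = some d →
      P (cfgM d lf))
    (hP_fin : P ⟨some (Sum.inr Ctrl.fin), (M.initialState, some true, some a),
      mkStk (update (botStk M) M.k₁ (w.map eOut.symm)) [] lf [] []⟩)
    (hP_end : P (cfg M none M.initialState (update (botStk M) M.k₁ (w.map eOut.symm)) [] lf [] [a])) :
    RunsVia (C := LCfg M) (loopTM M eIn eOut).step P (cfgM (initList M (u.map eIn.symm)) lf)
      (cfg M none M.initialState (update (botStk M) M.k₁ (w.map eOut.symm)) [] lf [] [a]) := by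
  have h1 := runM M eIn eOut P hrun lf hP_M
  rw [cfgM_haltList] at h1
  have e2 := step_test_true M eIn eOut M.initialState (botStk M) [] lf [] [] a (w.map eOut.symm)
  have e3 := step_fin M eIn eOut M.initialState (update (botStk M) M.k₁ (w.map eOut.symm)) [] lf [] []
    (some true) a
  simp only [List.map_cons] at h1
  exact h1.trans (RunsVia.step_trans e2 h1.last (RunsVia.single e3 hP_fin hP_end))

end Phases

/-! ### Work space and input invariant of the loop machine's configurations -/

section Space

/-- The number of stacks of `M`. [folklore] -/
noncomputable def nStk : ℕ := letI := M.kFin; Fintype.card M.K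

/-- The total length of the stacks of `M`. [folklore] -/
noncomputable def stkLen (S : ∀ k, List (M.Γ k)) : ℕ := letI := M.kFin; ∑ k, (S k).length

/-- The empty assignment has total length `0`. [folklore] -/
@[simp] theorem stkLen_bot : stkLen M (botStk M) = 0 := by
  simp [stkLen]

/-- Total length after writing one stack. [folklore] -/
theorem stkLen_update (S : ∀ k, List (M.Γ k)) (k : M.K) (L : List (M.Γ k)) :
    stkLen M (update S k L) + (S k).length = stkLen M S + L.length := by
  letI := M.kFin
  unfold stkLen
  have h1 : (fun j => (update S k L j).length) = update (fun j => (S j).length) k L.length := by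
    funext j
    by_cases h : j = k
    · subst h; simp
    · simp [update_of_ne h]
  have h2 : (fun j => (S j).length) = update (fun j => (S j).length) k (S k).length := by simp
  rw [h1]
  conv_rhs => rw [h2]
  rw [Finset.sum_update_of_mem (Finset.mem_univ k), Finset.sum_update_of_mem (Finset.mem_univ k)]
  omega

/-- Total length of a single-stack assignment. [folklore] -/
@[simp] theorem stkLen_update_bot (k : M.K) (L : List (M.Γ k)) :
    stkLen M (update (botStk M) k L) = L.length := by
  have := stkLen_update M (botStk M) k L
  rw [stkLen_bot] at this
  simpa using this

/-- Total length of the initial configuration of `M`. [folklore] -/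
@[simp] theorem stkLen_initList (l : List (M.Γ M.k₀)) : stkLen M (initList M l).stk = l.length := by
  rw [initList_eq]; exact stkLen_update_bot M M.k₀ l

/-- **Space used by a run of `M`**: after `n` steps the total stack length has grown by at most
`#stacks · D · n`, `D = machinePushBound` (from the per-stack bound `length_iterate_le`).
[cite: AroraBarak2009, Thm. 4.2 (a time-T computation touches O(T) cells)] -/
theorem stkLen_le_of_iterate {n : ℕ} {c d : M.Cfg} (h : (flip bind M.step)^[n] (some c) = some d) :
    stkLen M d.stk ≤ stkLen M c.stk + nStk M * machinePushBound M * n := by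
  letI := M.kFin
  unfold stkLen nStk
  calc ∑ k, (d.stk k).length ≤ ∑ k, ((c.stk k).length + machinePushBound M * n) :=
        Finset.sum_le_sum fun k _ => length_iterate_le M k n c d h
    _ = ∑ k, (c.stk k).length + Fintype.card M.K * machinePushBound M * n := by
        rw [Finset.sum_add_distrib, Finset.sum_const, Finset.card_univ, smul_eq_mul]; ring

/-- The work space of a configuration of the loop machine: the stacks of `M` and the auxiliary
stacks `TMP`, `OUT` (the input stacks `IN`, `LEFT` are not charged; cf. `workSpace_eq_ws`).
[cite: AroraBarak2009, Def. 4.1 (only work tapes are charged)] -/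
noncomputable def ws (c : LCfg M) : ℕ :=
  stkLen M (fun k => c.stk (Sum.inl k)) + (c.stk (Sum.inr Aux.TMP)).length + (c.stk (Sum.inr Aux.OUT)).length

/-- Work space of an explicit configuration. [folklore] -/
@[simp] theorem ws_mk (l : Option (M.Λ ⊕ Ctrl)) (var : St M.σ) (S : ∀ k, List (M.Γ k)) (i lf t o : List Bool) :
    ws M ⟨l, var, mkStk S i lf t o⟩ = stkLen M S + t.length + o.length := rfl

/-- Work space of a `cfg`. [folklore] -/
@[simp] theorem ws_cfg (l : Option (M.Λ ⊕ Ctrl)) (v : M.σ) (S : ∀ k, List (M.Γ k)) (i lf t o : List Bool) :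
    ws M (cfg M l v S i lf t o) = stkLen M S + t.length + o.length := rfl

/-- Work space of an embedded configuration of `M`. [folklore] -/
@[simp] theorem ws_cfgM (c : M.Cfg) (lf : List Bool) : ws M (cfgM c lf) = stkLen M c.stk := by
  simp [cfgM, ws]

/-- The read-only input invariant: `reverse LEFT ++ IN = x`. [cite: AroraBarak2009, Def. 4.1 (read-only input tape)] -/
def inv (x : List Bool) (c : LCfg M) : Prop :=
  (c.stk (Sum.inr Aux.LEFT)).reverse ++ c.stk (Sum.inr Aux.IN) = x

/-- Good configurations for input `x` and space bound `B`: work space `≤ B` and the input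
invariant. [folklore] -/
def Good (B : ℕ) (x : List Bool) (c : LCfg M) : Prop :=
  ws M c ≤ B ∧ inv M x c

/-- An explicit configuration is good. [folklore] -/
theorem good_mk {B : ℕ} {x : List Bool} {l : Option (M.Λ ⊕ Ctrl)} {var : St M.σ} {S : ∀ k, List (M.Γ k)}
    {i lf t o : List Bool} (h1 : stkLen M S + t.length + o.length ≤ B) (h2 : lf.reverse ++ i = x) :
    Good M B x ⟨l, var, mkStk S i lf t o⟩ :=
  ⟨h1, h2⟩

/-- A `cfg` is good. [folklore] -/
theorem good_cfg {B : ℕ} {x : List Bool} {l : Option (M.Λ ⊕ Ctrl)} {v : M.σ} {S : ∀ k, List (M.Γ k)}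
    {i lf t o : List Bool} (h1 : stkLen M S + t.length + o.length ≤ B) (h2 : lf.reverse ++ i = x) :
    Good M B x (cfg M l v S i lf t o) :=
  ⟨h1, h2⟩

/-- An embedded configuration of `M` (input already on `LEFT`) is good. [folklore] -/
theorem good_cfgM {B : ℕ} {x : List Bool} {c : M.Cfg} (h1 : stkLen M c.stk ≤ B) : Good M B x (cfgM c x.reverse) :=
  ⟨by simpa using h1, by simp [inv, cfgM]⟩

end Space

/-! ### The orbit of the iterated function and the full trajectory -/

section Trajectory

variable (F : List Bool → List Bool)

/-- **The orbit** of the loop: `o₀ = F (0x)`, `o_{k+1} = F (1 o_k)` — the successive outputs of the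
iterated machine (the round tag `0`/`1` tells the first round from the later ones). [folklore] -/
def orbit (x : List Bool) : ℕ → List Bool
  | 0 => F (false :: x)
  | k + 1 => F (true :: orbit x k)

/-- The successive INPUTS of the iterated machine: `0x`, then `1 o_k`. [folklore] -/
def fed (x : List Bool) : ℕ → List Bool
  | 0 => false :: x
  | k + 1 => true :: orbit F x k

/-- `orbit k = F (fed k)`. [folklore] -/
theorem orbit_eq (x : List Bool) (k : ℕ) : orbit F x k = F (fed F x k) := by
  cases k <;> rfl

/-- `orbit 0`. [folklore] -/
@[simp] theorem orbit_zero (x : List Bool) : orbit F x 0 = F (false :: x) := rfl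
/-- `orbit (k+1)`. [folklore] -/
@[simp] theorem orbit_succ (x : List Bool) (k : ℕ) : orbit F x (k + 1) = F (true :: orbit F x k) := rfl
/-- `fed 0`. [folklore] -/
@[simp] theorem fed_zero (x : List Bool) : fed F x 0 = false :: x := rfl
/-- `fed (k+1)`. [folklore] -/
@[simp] theorem fed_succ (x : List Bool) (k : ℕ) : fed F x (k + 1) = true :: orbit F x k := rfl

variable {F}

/-- **The full trajectory of the loop machine.** Suppose `M` computes `F` with `u ↦ F u` taking at
most `T |u|` steps (`T` monotone), the orbit of `x` raises the flag at round `N` with answer `a`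
(`o_N = 1 a w`) and not before (`o_k = 0 …` for `k < N`), and `A` bounds `|x| + 1` and all
`|o_k| + 1`, `k ≤ N`. Then from its initial configuration on `x` the loop machine halts with output
`[a]`, through configurations of work space `≤ A + #stacks · D · T(A)` satisfying the read-only
input invariant. [cite: AroraBarak2009, Thm. 4.2 and §4.1 (reusing space across iterations)] -/
theorem good_trajectory (T : ℕ → ℕ) (hT : Monotone T)
    (hF : ∀ u : List Bool, ∃ n ≤ T u.length,
      (flip bind M.step)^[n] (some (initList M (u.map eIn.symm))) = some (haltList M ((F u).map eOut.symm)))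
    (x : List Bool) (N : ℕ) (a : Bool) (w : List Bool)
    (hN : orbit F x N = true :: a :: w) (hlt : ∀ k < N, ∃ w', orbit F x k = false :: w')
    (A : ℕ) (hxA : x.length + 1 ≤ A) (hoA : ∀ k ≤ N, (orbit F x k).length + 1 ≤ A) :
    RunsVia (C := LCfg M) (loopTM M eIn eOut).step (Good M (A + nStk M * machinePushBound M * T A) x)
      (cfg M (some (Sum.inr Ctrl.load)) M.initialState (botStk M) x [] [] [])
      (cfg M none M.initialState (update (botStk M) M.k₁ (w.map eOut.symm)) [] x.reverse [] [a]) := by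
  set B := A + nStk M * machinePushBound M * T A with hB
  have hAB : A ≤ B := Nat.le_add_right _ _
  have hfedA : ∀ k ≤ N, (fed F x k).length ≤ A := by
    intro k hk
    cases k with
    | zero => simpa using hxA
    | succ k => simpa using hoA k (by omega)
  -- embedded runs of `M` stay good
  have hgoodM : ∀ k ≤ N, ∀ n ≤ T (fed F x k).length, ∀ j ≤ n, ∀ d,
      (flip bind M.step)^[j] (some (initList M ((fed F x k).map eIn.symm))) = some d →
      Good M B x (cfgM d x.reverse) := by
    intro k hk n hn j hj d hd
    apply good_cfgM
    have h1 := stkLen_le_of_iterate M hd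
    rw [stkLen_initList, List.length_map] at h1
    have h2 : nStk M * machinePushBound M * j ≤ nStk M * machinePushBound M * T A :=
      Nat.mul_le_mul_left _ (hj.trans (hn.trans (hT (hfedA k hk))))
    have h3 := hfedA k hk
    omega
  -- phase `load`
  have h0 := load_run M eIn eOut (Good M B x) M.initialState (botStk M) [] [] [] x
    (fun i₁ i₂ h => good_cfg M (by simp; have := congrArg List.length h; simp at this; omega) (by simp [h]))
    (good_cfg M (by simp; omega) (by simp))
  -- phase `feed false`
  have hstart_eq : cfgM (initList M ((fed F x 0).map eIn.symm)) x.reverse =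
      cfg M (some (Sum.inl M.main)) M.initialState
        (update (botStk M) M.k₀ (eIn.symm false ::
          ((x.reverse ++ []).reverse.map eIn.symm ++ botStk M M.k₀))) [] (x.reverse ++ []) [] [] := by
    rw [cfgM_initList]; simp
  have h1 := feed_run M eIn eOut (Good M B x) M.initialState false [] (x.reverse ++ []) [] (x.reverse ++ [])
    (botStk M)
    (fun t₁ t₂ h => good_cfg M
      (by have := congrArg List.length h; simp at this ⊢; omega) (by simp))
    (by rw [← hstart_eq]; exact hgoodM 0 (Nat.zero_le _) 0 (Nat.zero_le _) 0 le_rfl _ rfl)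
  rw [← hstart_eq] at h1
  -- the rounds
  have claim : ∀ k ≤ N, RunsVia (C := LCfg M) (loopTM M eIn eOut).step (Good M B x)
      (cfg M (some (Sum.inr Ctrl.load)) M.initialState (botStk M) x [] [] [])
      (cfgM (initList M ((fed F x k).map eIn.symm)) x.reverse) := by
    intro k
    induction k with
    | zero => intro _; exact h0.trans h1
    | succ k ih =>
      intro hk
      obtain ⟨w', hw'⟩ := hlt k (by omega)
      obtain ⟨n, hn, hrun⟩ := hF (fed F x k)
      rw [show F (fed F x k) = false :: w' from (orbit_eq F x k).symm.trans hw'] at hrun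
      have hoAk := hoA k (by omega)
      rw [hw'] at hoAk
      simp only [List.length_cons] at hoAk
      have hr := round_continue M eIn eOut (Good M B x) x.reverse (fed F x k) w' hrun
        (hgoodM k (by omega) n hn)
        (fun L₁ L₂ h => good_cfg M
          (by have := congrArg List.length h; simp at this ⊢; omega) (by simp))
        (fun t₁ t₂ h => good_cfg M
          (by have := congrArg List.length h; simp at this ⊢; omega) (by simp))
        (good_cfgM M (by rw [stkLen_initList]; simp at hoAk ⊢; omega))
      have hfed : fed F x (k + 1) = true :: false :: w' := by rw [fed_succ, hw']
      rw [hfed]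
      exact (ih (by omega)).trans hr
  -- the last round
  obtain ⟨n, hn, hrun⟩ := hF (fed F x N)
  rw [show F (fed F x N) = true :: a :: w from (orbit_eq F x N).symm.trans hN] at hrun
  have hoAN := hoA N le_rfl
  rw [hN] at hoAN
  simp only [List.length_cons] at hoAN
  have hr := round_halt M eIn eOut (Good M B x) x.reverse (fed F x N) w a hrun
    (hgoodM N le_rfl n hn)
    (good_mk M (by simp; omega) (by simp))
    (good_cfg M (by simp; omega) (by simp))
  exact (claim N le_rfl).trans hr

end Trajectory

/-! ### The loop machine as a space-bounded decider -/

section Decider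

/-- The initial configuration of the space machine. [folklore] -/
theorem spaceMachine_init (l : List Bool) :
    (spaceMachine M eIn eOut).init l = cfg M (some (Sum.inr Ctrl.load)) M.initialState (botStk M) l [] [] [] := by
  have h : l.map (spaceMachine M eIn eOut).inputAlphabet.symm = l := by
    show List.map (⇑(Equiv.refl Bool).symm) l = l
    simp only [Equiv.refl_symm, Equiv.coe_refl, List.map_id]
  rw [SpaceMachine.init, h]
  exact initList_loopTM M eIn eOut l

/-- The charged stacks of the space machine are the stacks of `M` and `TMP`, `OUT`. [folklore] -/
theorem workStacks_eq :
    letI := M.kFin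
    ((Finset.univ : Finset (M.K ⊕ Aux)).erase (Sum.inr Aux.IN)).erase (Sum.inr Aux.LEFT) =
      Finset.univ.image Sum.inl ∪ {Sum.inr Aux.TMP, Sum.inr Aux.OUT} := by
  ext j
  rcases j with k | a
  · simp
  · cases a <;> simp

/-- **The work space of the space machine is `ws`.** [cite: AroraBarak2009, Def. 4.1] -/
theorem workSpace_eq_ws (c : LCfg M) : (spaceMachine M eIn eOut).workSpace c = ws M c := by
  letI := M.kFin
  unfold SpaceMachine.workSpace
  change ∑ k ∈ ((Finset.univ : Finset (M.K ⊕ Aux)).erase (Sum.inr Aux.IN)).erase (Sum.inr Aux.LEFT),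
    (c.stk k).length = _
  rw [workStacks_eq, Finset.sum_union, Finset.sum_image (fun a _ b _ h => Sum.inl_injective h),
    Finset.sum_pair (by simp)]
  · simp only [ws, stkLen]
    omega
  · rw [Finset.disjoint_left]
    rintro j hj hj'
    simp only [Finset.mem_image, Finset.mem_univ, true_and] at hj
    obtain ⟨k, rfl⟩ := hj
    simp at hj'

variable {Mx : TM2ComputableAux Bool Bool} {F : List Bool → List Bool} {T : ℕ → ℕ}

/-- **The loop machine decides in bounded space.** If `Mx` computes `F` within the monotone time
bound `T`, every orbit word of `x` has length `≤ s |x|`, and the orbit of every `x` raises the flag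
(for the first time) with the answer `[x ∈ L]`, then the space machine of the loop decides `L` in
work space `A + #stacks · D · T(A)`, `A = |x| + s |x| + 2`, and respects the read-only input.
[cite: AroraBarak2009, Thm. 4.2 and §4.1 (space-bounded computation; reuse of space)] -/
theorem decidesInSpace (hT : Monotone T) (hF : ∀ u, Mx.OutputsWithin u (F u) (T u.length))
    (L : Language Bool) (s : ℕ → ℕ) (hs : ∀ x k, (orbit F x k).length ≤ s x.length)
    (hhalt : ∀ x, ∃ N w, orbit F x N = true :: L.boolIndicator x :: w ∧
      ∀ k < N, ∃ w', orbit F x k = false :: w') :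
    DecidesInSpace (spaceMachine Mx.tm Mx.inputAlphabet Mx.outputAlphabet) L
      (fun x => (x.length + s x.length + 2) +
        nStk Mx.tm * machinePushBound Mx.tm * T (x.length + s x.length + 2)) := by
  have hF' : ∀ u : List Bool, ∃ n ≤ T u.length, (flip bind Mx.tm.step)^[n]
      (some (initList Mx.tm (u.map Mx.inputAlphabet.symm))) =
        some (haltList Mx.tm ((F u).map Mx.outputAlphabet.symm)) := fun u =>
    TM2Iter.reachesIn_of_outputsWithin Mx (hF u)
  -- the trajectory of every input
  have traj : ∀ x, ∃ w : List Bool, RunsVia (C := LCfg Mx.tm) (loopTM Mx.tm Mx.inputAlphabet Mx.outputAlphabet).step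
      (Good Mx.tm ((x.length + s x.length + 2) +
        nStk Mx.tm * machinePushBound Mx.tm * T (x.length + s x.length + 2)) x)
      ((spaceMachine Mx.tm Mx.inputAlphabet Mx.outputAlphabet).init x)
      (cfg Mx.tm none Mx.tm.initialState (update (botStk Mx.tm) Mx.tm.k₁ (w.map Mx.outputAlphabet.symm))
        [] x.reverse [] [L.boolIndicator x]) := by
    intro x
    obtain ⟨N, w, hN, hlt⟩ := hhalt x
    refine ⟨w, ?_⟩
    rw [spaceMachine_init]
    exact good_trajectory Mx.tm Mx.inputAlphabet Mx.outputAlphabet T hT hF' x N (L.boolIndicator x) w hN hlt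
      (x.length + s x.length + 2) (by omega) (fun k _ => by have := hs x k; omega)
  have hnone : ∀ (x w : List Bool), (loopTM Mx.tm Mx.inputAlphabet Mx.outputAlphabet).step
      (cfg Mx.tm none Mx.tm.initialState (update (botStk Mx.tm) Mx.tm.k₁ (w.map Mx.outputAlphabet.symm))
        [] x.reverse [] [L.boolIndicator x]) = none := fun x w => rfl
  refine ⟨fun x c hc => ?_, fun x => ⟨?_, fun c hc => ?_⟩⟩
  · -- read-only input
    obtain ⟨w, hw⟩ := traj x
    have hg := (hw.forall_reaches (hnone x w) c hc).2
    have e : ∀ l : List Bool, List.map (⇑(Equiv.refl Bool)) l = l := fun l => List.map_id'' (fun _ => rfl) l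
    show (List.map (⇑(Equiv.refl Bool)) (c.stk (Sum.inr Aux.LEFT))).reverse ++
      List.map (⇑(Equiv.refl Bool)) (c.stk (Sum.inr Aux.IN)) = x
    rw [e, e]
    exact hg
  · -- halting with the right answer
    obtain ⟨w, hw⟩ := traj x
    exact ⟨_, hw.mem_eval (hnone x w), rfl⟩
  · -- space
    obtain ⟨w, hw⟩ := traj x
    have hg := hw.forall_reaches (hnone x w) c hc
    rw [workSpace_eq_ws]
    exact hg.1

/-- **Space-bounded iteration of an `FP` function decides `PSPACE` languages.** Let `F ∈ FP` and
let the orbit `o₀ = F (0x)`, `o_{k+1} = F (1 o_k)` of every input `x` consist of words of length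
`≤ s(|x|)` for a polynomial `s`, and raise the flag (first symbol `1`) for the first time with second
symbol `[x ∈ L]`. Then `L ∈ PSPACE`: the loop machine recomputes `F` in place, so its work space is
the space of ONE run of the polynomial-time machine of `F` on a word of polynomial length.
[cite: AroraBarak2009, Thm. 4.2 and §4.1 (DTIME(T) ⊆ SPACE(T); space is reused)] -/
theorem mem_PSPACE {L : Language Bool} {F : List Bool → List Bool} (hF : F ∈ FP) (s : Polynomial ℕ)
    (hs : ∀ x k, (orbit F x k).length ≤ s.eval x.length)
    (hhalt : ∀ x, ∃ N w, orbit F x N = true :: L.boolIndicator x :: w ∧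
      ∀ k < N, ∃ w', orbit F x k = false :: w') :
    L ∈ PSPACE := by
  obtain ⟨p, Mx, hMx⟩ := hF
  have hT : Monotone fun n => p.eval n := fun a b h => TM2Iter.eval_mono p h
  have hD := decidesInSpace (Mx := Mx) (F := F) (T := fun n => p.eval n) hT (fun u => hMx u) L
    (fun n => s.eval n) hs hhalt
  -- the space bound is a polynomial `q`
  set q : Polynomial ℕ := (Polynomial.X + s + 2) +
    Polynomial.C (nStk Mx.tm * machinePushBound Mx.tm) * p.comp (Polynomial.X + s + 2) with hq
  have hq_eval : ∀ n, q.eval n = (n + s.eval n + 2) + nStk Mx.tm * machinePushBound Mx.tm * p.eval (n + s.eval n + 2) := by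
    intro n; simp [hq, Polynomial.eval_comp]
  obtain ⟨c, k, hck⟩ := exists_eval_le_mul_pow_add q
  refine Set.mem_iUnion.2 ⟨k, c, spaceMachine Mx.tm Mx.inputAlphabet Mx.outputAlphabet, hD.1, fun x => ⟨(hD.2 x).1, ?_⟩⟩
  refine ((hD.2 x).2).mono ?_
  dsimp only
  rw [← hq_eval]
  exact hck x.length

/-- **The loop machine decides in bounded space — bound required only up to the flag.** As
`decidesInSpace`, but the length bound `s` is only demanded of the orbit words `o_k` all of whose
predecessors `o_j`, `j < k`, are unflagged (the words the machine actually computes: after the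
first flag the machine halts). [cite: AroraBarak2009, Thm. 4.2 and §4.1 (space-bounded computation; reuse of space)] -/
theorem decidesInSpace_of_bound_until_flag (hT : Monotone T) (hF : ∀ u, Mx.OutputsWithin u (F u) (T u.length))
    (L : Language Bool) (s : ℕ → ℕ)
    (hs : ∀ x k, (∀ j < k, ∃ w', orbit F x j = false :: w') → (orbit F x k).length ≤ s x.length)
    (hhalt : ∀ x, ∃ N w, orbit F x N = true :: L.boolIndicator x :: w ∧
      ∀ k < N, ∃ w', orbit F x k = false :: w') :
    DecidesInSpace (spaceMachine Mx.tm Mx.inputAlphabet Mx.outputAlphabet) L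
      (fun x => (x.length + s x.length + 2) +
        nStk Mx.tm * machinePushBound Mx.tm * T (x.length + s x.length + 2)) := by
  have hF' : ∀ u : List Bool, ∃ n ≤ T u.length, (flip bind Mx.tm.step)^[n]
      (some (initList Mx.tm (u.map Mx.inputAlphabet.symm))) =
        some (haltList Mx.tm ((F u).map Mx.outputAlphabet.symm)) := fun u =>
    TM2Iter.reachesIn_of_outputsWithin Mx (hF u)
  -- the trajectory of every input
  have traj : ∀ x, ∃ w : List Bool, RunsVia (C := LCfg Mx.tm) (loopTM Mx.tm Mx.inputAlphabet Mx.outputAlphabet).step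
      (Good Mx.tm ((x.length + s x.length + 2) +
        nStk Mx.tm * machinePushBound Mx.tm * T (x.length + s x.length + 2)) x)
      ((spaceMachine Mx.tm Mx.inputAlphabet Mx.outputAlphabet).init x)
      (cfg Mx.tm none Mx.tm.initialState (update (botStk Mx.tm) Mx.tm.k₁ (w.map Mx.outputAlphabet.symm))
        [] x.reverse [] [L.boolIndicator x]) := by
    intro x
    obtain ⟨N, w, hN, hlt⟩ := hhalt x
    refine ⟨w, ?_⟩
    rw [spaceMachine_init]
    exact good_trajectory Mx.tm Mx.inputAlphabet Mx.outputAlphabet T hT hF' x N (L.boolIndicator x) w hN hlt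
      (x.length + s x.length + 2) (by omega)
      (fun k hk => by have := hs x k (fun j hj => hlt j (Nat.lt_of_lt_of_le hj hk)); omega)
  have hnone : ∀ (x w : List Bool), (loopTM Mx.tm Mx.inputAlphabet Mx.outputAlphabet).step
      (cfg Mx.tm none Mx.tm.initialState (update (botStk Mx.tm) Mx.tm.k₁ (w.map Mx.outputAlphabet.symm))
        [] x.reverse [] [L.boolIndicator x]) = none := fun x w => rfl
  refine ⟨fun x c hc => ?_, fun x => ⟨?_, fun c hc => ?_⟩⟩
  · obtain ⟨w, hw⟩ := traj x
    have hg := (hw.forall_reaches (hnone x w) c hc).2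
    have e : ∀ l : List Bool, List.map (⇑(Equiv.refl Bool)) l = l := fun l => List.map_id'' (fun _ => rfl) l
    show (List.map (⇑(Equiv.refl Bool)) (c.stk (Sum.inr Aux.LEFT))).reverse ++
      List.map (⇑(Equiv.refl Bool)) (c.stk (Sum.inr Aux.IN)) = x
    rw [e, e]
    exact hg
  · obtain ⟨w, hw⟩ := traj x
    exact ⟨_, hw.mem_eval (hnone x w), rfl⟩
  · obtain ⟨w, hw⟩ := traj x
    have hg := hw.forall_reaches (hnone x w) c hc
    rw [workSpace_eq_ws]
    exact hg.1

/-- **Space-bounded iteration decides `PSPACE` languages — bound required only up to the flag.**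
As `mem_PSPACE`, but the polynomial bound on the orbit words is only demanded before (and at) the
first flagged word; what `F` does after the flag is irrelevant. [cite: AroraBarak2009, Thm. 4.2 and §4.1 (DTIME(T) ⊆ SPACE(T); space is reused)] -/
theorem mem_PSPACE_of_bound_until_flag {L : Language Bool} {F : List Bool → List Bool} (hF : F ∈ FP)
    (s : Polynomial ℕ)
    (hs : ∀ x k, (∀ j < k, ∃ w', orbit F x j = false :: w') → (orbit F x k).length ≤ s.eval x.length)
    (hhalt : ∀ x, ∃ N w, orbit F x N = true :: L.boolIndicator x :: w ∧
      ∀ k < N, ∃ w', orbit F x k = false :: w') :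
    L ∈ PSPACE := by
  obtain ⟨p, Mx, hMx⟩ := hF
  have hT : Monotone fun n => p.eval n := fun a b h => TM2Iter.eval_mono p h
  have hD := decidesInSpace_of_bound_until_flag (Mx := Mx) (F := F) (T := fun n => p.eval n) hT
    (fun u => hMx u) L (fun n => s.eval n) hs hhalt
  set q : Polynomial ℕ := (Polynomial.X + s + 2) +
    Polynomial.C (nStk Mx.tm * machinePushBound Mx.tm) * p.comp (Polynomial.X + s + 2) with hq
  have hq_eval : ∀ n, q.eval n = (n + s.eval n + 2) + nStk Mx.tm * machinePushBound Mx.tm * p.eval (n + s.eval n + 2) := by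
    intro n; simp [hq, Polynomial.eval_comp]
  obtain ⟨c, k, hck⟩ := exists_eval_le_mul_pow_add q
  refine Set.mem_iUnion.2 ⟨k, c, spaceMachine Mx.tm Mx.inputAlphabet Mx.outputAlphabet, hD.1, fun x => ⟨(hD.2 x).1, ?_⟩⟩
  refine ((hD.2 x).2).mono ?_
  dsimp only
  rw [← hq_eval]
  exact hck x.length

end Decider

end Bundled

end SpaceLoop

end Literature.Computability.Complexity
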